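import Mathlib
import HarnessLib
import HarnessLib.Audit
import Summits.NavierStokesRegularity.Statement
import Literature.Analysis.FluidPDE.ClassicalSolution
import Literature.Analysis.FluidPDE.LerayHopf
import Literature.Analysis.FluidPDE.SuitableWeak
import Literature.Analysis.FluidPDE.NSWave0
import Summits.NavierStokesRegularity.NavierStokesRegularity.Theorems.TypeICertificateLadderNoBlowupToClay
import HarnessLib.Audit.Status.Attr

/-!
Route: MarginalReynoldsCreep

# Route MarginalReynoldsCreep — a singularity must be asymptotically free — the local Reynolds
number creeps by a one-loop law whose sign decides

It suffices to show X = OneLoopCreep ∧ NoLinearCreep ∧ NoStrongTypeII ∧ NoBreathing (card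
marginal-reynolds-creep-kappa). Read the
Type-I constant of a maximal finite-energy classical solution u on [0,T) from Clay data as a RUNNING
COUPLING: local Reynolds number
R(t) := (T−t)‖u(t)‖²_∞/ν, ε := 1/R, log-time s := −log(T−t) (ds = dt/(T−t)). Junk-free bookkeeping,
all inlined: Type I ⇔ R bounded
(IsTypeIBlowup); BREATHING ⇔ limsup R = ∞ > liminf R; STRONG Type II ⇔ ∫^∞ ε ds < ∞ (viscosity
integrates out: a positive minorant
m(t) ≤ ‖u(t,x_t)‖ with ∫^T dt/((T−t)² m²) < ∞); MARGINAL ⇔ R → ∞ with ∫ε ds = ∞. NoBreathing: not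
Type I ⇒ R → ∞. NoStrongTypeII
(Kelvin marginality): R → ∞ ⇒ ∫ε ds = ∞. OneLoopCreep (the modulation law, integrated): a marginal
singularity creeps EXACTLY linearly,
(T−t)‖u(t)‖²_∞ ~ κν|log(T−t)| for one κ > 0 (one loop: ε′ = −κε² ⇒ R ≈ κs). NoLinearCreep (the sign
theorem, "viscosity is marginally
relevant", κ(W) < 0 at every Euler–Leray skeleton): no singularity creeps linearly. X ⇒ NoTypeII
(shared target stmt-0056) by pure
logic; with the shared NoTypeIBlowup (stmt-1217) and NoBlowupToClay (stmt-0055), Clay (A).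
Lean: `OneLoopCreep ∧ NoLinearCreep ∧ NoStrongTypeII ∧ NoBreathing`

## Assembly
Pure logic, PROVED sorry-free (glue.lean `closes`, lean check rc 0 on Sketch.lean, axioms
propext/Classical.choice/Quot.sound): apply
NoBlowupToClay; given ν, T and a classical Leray–Hopf solution u from a rapidly decaying datum on
[0,T) with no smooth extension, u is maximal;
if Type I, NoTypeIBlowup extends it (contradiction); otherwise NoBreathing gives R → ∞,
NoStrongTypeII says viscosity never integrates out
(marginal), OneLoopCreep yields a linear creep rate κ > 0, and NoLinearCreep refutes it. The same
four cruxes give the shared target NoTypeII.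

Rationale: WHY THIS LINE. Dimensional analysis leaves exactly one Type-II regime un-excluded at the Leray
length: Kelvin's circulation invariance pins Euler-driven
self-similar collapse to the length exponent γ = ½ (ConstantinIgnatovaVicol2026Putative,
arXiv:2602.17570: γ ≥ 2/5 for finite energy,
γ ≥ ½ for outgoing profiles, γ = ½ with swirl at a stagnation point; γ > ½ impossible for NS, Prop.
nse), the exact γ = ½ viscous profile
is dead (NecasRuzickaSverak1996, Tsai1998, Chae2007, ChaeWolf2017RemovingDSS, PineauVicol2026) and
every exclusion stops one logarithm short
(Tao2021QuantitativeNS: triple log) — so an asymptotically self-similar singularity must be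
MARGINAL, R → ∞ only logarithmically, which is
what Hou's fits show (Hou2022PotentiallySingularNS §3.4: ‖u‖∞ ~ (T−t)^{-1/2}, ‖ω‖∞ ~
|log(T−t)|/(T−t), "rate most likely not exactly ½";
Hou2026 = arXiv:2405.10916 §1.2: explicit factor λ(t) = (1+ε|log(T−t)|)^{-1/2}). Imported area:
MODULATION THEORY of critical blow-up
(MerleRaphael2005 log-log; RaphaelSchweyer2011 = arXiv:1106.0914, (T−t)/|log|² from a neutral mode;
MerleEtAl2022, viscous transfer along
an inviscid profile) with the explicit dictionary ground state Q ↦ steady/log-periodic Euler–Leray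
skeleton W (½(W+y·∇W)+W·∇W+∇Π = 0,
dilation family μ⁻¹W(μ·)), scale λ ↦ ε = 1/R, orthogonality ↦ Fredholm solvability of L_W W₁ = ΔW −
Σṗ∂_pW against the adjoint zero modes,
log rate ↦ log-dressed Leray scaling; the solvability condition is printed heuristically in
PomeauBerreLehner2018 §5 (arXiv:1806.04893,
after Pomeau2017: "a small viscosity causes a drift of the Euler–Leray solution in the dilation
parameter", fates μ → 0 or a fixed point)
and is here turned into a one-loop RG law ε′ = −κ(W)ε² with a SIGN DICHOTOMY: κ > 0 asymptotic
freedom (R ≈ κs, the consistent log-dressed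
template OneLoopCreep describes), κ < 0 exit to Type I (killed by NoTypeIBlowup: SereginSverak2009
in the axisymmetric class, (L′) in
general), κ = 0 two-loop creep. What no prior route does: TypeIIInviscidRelaxation splits R → ∞ by
the symmetry class of the core,
VortexLineClock/kelvin-quantized cards own the strong window γ < ½, MarginalTypeI the critical
viscosity; nobody gives R a DYNAMICAL LAW.
This route splits Type II by ∫ε ds (strong | marginal | breathing) and decides the marginal class by
the sign of one computable coefficient.
Negatives index: empty at filing.

RANKED CRUXES. #0 NoTypeII (target) — shared target stmt-NavierStokesRegularity-0056 (verbatim): a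
finite-energy classical solution from a rapidly decaying datum with finite maximal lifespan T blows
up at most at the Type-I rate. X ⇒ NoTypeII by pure logic (Sketch.lean `target_of_cruxes`). (why it
might fail: a finite-energy Type-II singularity is ¬Clay(A) outright; Tao's averaged blow-up is Type
II (arXiv:1402.0290 p.8), Hou's axisymmetric scenario would be Type II if singular (KNSS2009).)
[KochNadirashviliSereginSverak2009, Hou2022PotentiallySingularNS, Seregin2024,
Tao2021QuantitativeNS]
#2 OneLoopCreep (crux) — ONE-LOOP CREEP LAW (card K1, integrated and made unconditional). For a
maximal finite-energy classical solution from Clay data with R(t) = (T−t)‖u(t)‖²∞/ν → ∞ (∀M,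
eventually some x has M ≤ (T−t)|u(t,x)|²) which is NOT strong Type II (no positive minorant m ≤
‖u(t,x_t)‖ with ∫^T dt/((T−t)²m²) < ∞, i.e. ∫ds/R = ∞), there is κ > 0 with
(T−t)‖u(t)‖²∞/(ν|log(T−t)|) → κ (two-sided: for every δ > 0, eventually some x beats (κ−δ) and all x
stay below (κ+δ)). Mechanism: shadowing of the γ = ½ Euler–Leray skeleton W modulo symmetries,
modulation U = W(·;p(s)) + εW₁ + w, Fredholm solvability ⇒ ε′ = −κ(W)ε² + o(ε²) ⇒ R/s → κ(W);
marginality forces κ(W) ≥ 0 and one loop forces > 0. [difficulty: XL] (why it might fail: L_W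
(transport by W+½y plus stretching) is non-normal with no spectral gap off the symmetry modes, so w
need not stay slaved; zooms may not converge (chaotic/precessing skeleton); κ(W)=0 gives two-loop
creep R~√s; swirl-starvation predicts R ≲ s^{2/3} in ω_θ-driven AX scenarios.)
[PomeauBerreLehner2018, RaphaelSchweyer2011, MerleRaphael2005, MerleEtAl2022, Hou2026,
arXiv:1204.4625]
#3 NoLinearCreep (crux) — SIGN THEOREM, global form (card K2: "viscosity is marginally relevant",
κ(W) < 0 for every admissible Euler–Leray skeleton; equivalently no asymptotically free
singularity). No maximal finite-energy classical solution from Clay data has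
(T−t)‖u(t)‖²∞/(ν|log(T−t)|) → κ with 0 < κ < ∞ (two-sided, as in OneLoopCreep). Route of proof:
linear creep ⇒ the sup-normalised zooms at the advective length √(νR(T−t)) shadow a steady or
log-periodic solution W of ½(W+y·∇W)+W·∇W+∇Π = 0 (C², |W| ≲ ⟨y⟩⁻¹, |∇W| ≲ ⟨y⟩⁻²) ⇒ κ = κ(W) = the
Fredholm ratio of ⟨ΔW, Z⟩ against the dilation/amplitude adjoint zero modes ⇒ show κ(W) < 0
(axisymmetric bounded-swirl skeletons first), or that no admissible W exists at all (card
leray-euler-affine-bernoulli). [difficulty: open-problem] (why it might fail: the sign is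
profile-dependent in every dispersive analogue (stable and unstable log regimes both occur); Hou's
10⁷-fold vorticity growth at fixed ν with |log|-dressed fits is numerical evidence FOR a κ > 0
skeleton — which would be ¬Clay(A).) [Hou2022PotentiallySingularNS, Hou2026, PomeauBerreLehner2018,
MerleRaphael2005, ConstantinIgnatovaVicol2026Putative, Chae2007]
#4 NoStrongTypeII (crux) — KELVIN MARGINALITY — viscosity never integrates out. For a maximal
finite-energy classical solution from Clay data, R(t) → ∞ ⇒ ∫^∞ ds/R = ∞: there is NO positive
minorant m(t) ≤ ‖u(t,x_t)‖ on some (t₀,T) with ∫ dt/((T−t)² m(t)²) < ∞ (this kills every power rate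
‖u‖∞ ≳ (T−t)^{-a}, a > ½, i.e. every collapse length (T−t)^γ with γ < ½). In print for outgoing /
axisymmetric-with-swirl globally self-similar Euler profiles (CIV 2026: circulation e^{(1−2γ)τ}Γ is
invariant along self-similar trajectories, so a trapped loop forces γ = ½); the crux is the
statement for general finite-energy NS singularities (shared in spirit with cards
kelvin-quantized-similarity-exponent, euler-window-viscous-transfer and route VortexLineClock's
EmptyEulerWindow). [difficulty: open-problem] (why it might fail: Kelvin pins γ=½ only for
(approximately) SELF-SIMILAR Euler collapse with a trapped loop; a multiscale cascade or sheet
roll-up can keep every circulation bounded while sup|u| outruns (T−t)^{-1/2} (ℓ ≪ |u|(T−t)); CIV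
need outgoing/analyticity hypotheses even in the self-similar case.)
[ConstantinIgnatovaVicol2026Putative, GinibreLeberrePomeau2019, Chae2007, Seregin2024,
Elgindi2025IdealFluidDynamics]
#5 NoBreathing (crux) — NO BREATHING (card K3). For a maximal finite-energy classical solution from
Clay data, failure of the Type-I bound (limsup R = ∞) forces R(t) → ∞ (∀M, eventually in t some x
has M ≤ (T−t)|u(t,x)|²): the running coupling cannot return to O(1) infinitely often. Intended
proof: from a quiescent similarity-time window with R ≤ M, compactness of Type-I(M) configurations
(Albritton–Barker / Seregin local Type-I calculus) bounds the amplification reachable in similarity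
time τ by G(M,τ), so bursts of unbounded height need unbounded build-up windows; show a recurrent
skeleton cannot have identically vanishing cycle-averaged κ. [difficulty: L] (why it might fail: a
log-periodic (DSS-like) skeleton with exactly zero cycle-averaged κ ('breathing DSS', R oscillating
between O(1) and ∞ along t↑T) is non-generic but not obviously impossible; Type-I(M) compactness
controls similarity-time windows, not their number.) [AlbrittonBarker2019, ChaeWolf2017RemovingDSS,
SereginSverak2009, Seregin2024, KochNadirashviliSereginSverak2009]
#9 NoTypeIBlowup (support) — shared stmt-NavierStokesRegularity-1217 (verbatim): EXIT KILL (card K4)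
— a classical Leray–Hopf solution from a rapidly decaying datum blowing up at most at the Type-I
rate extends smoothly past T (axisymmetric case: Seregin–Šverák 2009 / barrier
AxisymmetricTypeIExclusion; general case: (L′), owned by routes TypeILiouville /
ExtremalTypeIConstant / SymmetryModuliCount). [difficulty: open-problem]
[KochNadirashviliSereginSverak2009, SereginSverak2009, AlbrittonBarker2019]
#9 NoBlowupToClay (support) — shared stmt-NavierStokesRegularity-0055 (verbatim): given no blow-up
of finite-energy classical solutions from Clay data, build the Clay (A) solution (local theory +
continuation + weak–strong uniqueness + energy inequality). [difficulty: provable-now] [Leray1934,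
Fefferman2000, KochNadirashviliSereginSverak2009]

TWO-LAYER PLAN. Foreseen glued splits (nothing filed now; they wait for the definition requests
below). NoLinearCreep ⇐ ZoomSkeleton (linear creep ⇒ the
sup-normalised zooms at length √(νR(T−t)) converge modulo rotations/translations, subsequentially in
s, to an admissible Euler–Leray skeleton
W) → ModulationLaw (shadowing W with ε → 0 ⇒ R/s → κ(W), the Fredholm ratio) → KappaNegative (κ(W) <
0 for every admissible W; AX bounded
swirl first) → NoLinearCreep. OneLoopCreep ⇐ ZoomSkeleton′ (marginal ⇒ shadowing) → ModulationLaw →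
OneLoopCreep (shares two children).
NoBreathing ⇐ TypeIWindowCompactness (amplification bound G(M,τ) from a Type-I(M) window) →
NoZeroMeanCycle → NoBreathing. NoStrongTypeII ⇐
StrongIsSelfSimilarEuler (∫ε ds < ∞ ⇒ Euler-scaling zoom converges to a self-similar/DSS Euler
profile with a trapped loop, cf. Seregin2024)
→ KelvinPinning (CIV's e^{(1−2γ)τ}Γ invariance incl. the DSS case) → NoStrongTypeII.

KILL CRITERIA. Any refutation of OneLoopCreep, NoLinearCreep, NoStrongTypeII or NoBreathing exhibits
a finite-energy blow-up from Clay data, i.e. settles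
¬Clay(A): close `refuted:<Decl>` and hand the witness to the negative side (a κ(W) > 0 skeleton with
finite-codimension stability is the
card's log-dressed blow-up template; file it as a refutation route through Blowup's X5a/X5b).
Model-level evidence forcing a PIVOT (not a
close): a kit fit of Hou's data with √(T−t)‖u‖∞ ≁ |log|^{1/2} (e.g. exponent ≤ 1/3, the
swirl-starvation value) ⇒ restate OneLoopCreep with
the measured creep exponent (two-loop / starved law) and re-derive; a computed κ(W) > 0 for a
credible skeleton ⇒ this positive route goes
dormant and the negative template is filed. NoTypeII proved elsewhere (TypeIIInviscidRelaxation,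
VortexLineClock, CoreLogGas …) moots the
four cruxes; NoTypeIBlowup refuted (a Type-I blow-up) breaks this route together with every NoTypeII
route.

NOT DECOMPOSED YET. The skeleton class (steady vs s-periodic Euler–Leray solutions, decay |W| ≲
⟨y⟩⁻¹, cusp/inner viscous layer at non-resonant stagnation
saddles which renormalises κ — card resonant-saddle-quantisation), the operator L_W, its adjoint
zero modes and the Fredholm ratio κ(W)
(definition requests), the weighted space in which the remainder w is slaved, the compactness lemma
behind ZoomSkeleton, and the constants
G(M,τ) of NoBreathing — all layer-2. The NEGATIVE ladder of the card (ansatz lemma: every force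
class L^p_tL^q_x with 2/p+3/q > 3 admits
trivial self-similar-cutoff blow-up; rung k: blow-up under a critical×|log|^{-(k+1)} force from the
k-loop dressed skeleton) is not an item
of this positive route; it becomes a refutation route if a κ > 0 skeleton is found. Prior-programme
notes: not read (plancard mode).

CHEAPEST FALSIFIER. (i) kit: digitise Hou2022PotentiallySingularNS Fig. 'linear regression vel'
(§3.4.1) / rerun the axisymmetric solver and fit √(T−t)‖u(t)‖∞ =
a + b|log(T−t)|^p — OneLoopCreep predicts p = ½ exactly (R ≈ κs), swirl-starvation-creep-window
predicts p ≤ 1/3; p clearly ≠ ½ kills the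
one-loop universality as stated. (ii) literature: a printed modulation/RG derivation of
log-corrected Leray scaling for NS with the sign
computed (searched: only the heuristic solvability condition of PomeauBerreLehner2018 §5, no sign,
no R → ∞ branch). (iii) compute κ for the
n = 3.188 constant-viscosity self-similar profile of Hou2026 continued towards n = 3. Not run here
(hub is compute-free for planners in
plancard mode; recorded for the refuter).

NUMBERS. Leray floor R(t) ≥ c² (in-tree named fact
Literature.Analysis.FluidPDE.leray_blowup_rate_top: ‖u(t)‖∞ ≥ c√ν(T−t)^{-1/2}). CIV 2026
(arXiv:2602.17570): finite energy ⇒ γ ≥ 2/5; outgoing smooth global profile ⇒ γ ≥ ½; axisymmetric,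
swirl ≠ 0 at a stagnation point ⇒
γ = ½; NS approximate self-similarity with γ > ½ ⇒ no blow-up (ω ∈ L⁴_tL²_x).
Hou2022PotentiallySingularNS §3.4: R(t), Z(t) ~ (T−t)^{1/2},
‖u‖∞ ~ (T−t)^{-1/2}, ‖ω‖∞ ~ |log(T−t)|/(T−t), vorticity amplification 10⁷; Hou2026 §1.2/§5: λ(t) =
(1+ε|log(T−t)|)^{-1/2},
∫‖u‖²∞ linear in τ, self-similar only at dimension n ≈ 3.188 (constant ν). Tao2021QuantitativeNS:
‖u‖_{L³} ≥ (logloglog 1/(T−t))^c along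
a sequence. One loop: ε′ = −κε² ⇒ R = κs + o(s), ‖u‖∞ ≈ (κν|log(T−t)|/(T−t))^{1/2}; two loop (κ =
0): R ~ s^{1/2}. Items at open: 8
(1 target, 4 cruxes, 2 shared supports, 1 assembly).

DEFINITION REQUESTS. D1 `EulerLeraySkeleton` (topic
Summits/NavierStokesRegularity/NavierStokesRegularity/Theorems): the admissible skeleton class — W ∈
C²(ℝ³;ℝ³),
div W = 0, |W| ≲ ⟨y⟩⁻¹, |∇W| ≲ ⟨y⟩⁻², solving ½(W + y·∇W) + W·∇W + ∇Π = 0 for some Π (steady case;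
s-periodic variant later), with its
dilation family μ⁻¹W(μ·). D2 `oneLoopKappa W` (same topic): the Fredholm ratio κ(W) built from ⟨ΔW,
Z⟩ for Z in the kernel of the adjoint
linearised similarity-Euler operator L_W* paired against the dilation/amplitude modes — to be
posited as an INTERFACE (structure: L_W, a
finite-dimensional adjoint kernel containing the symmetry modes, the ratio) plus a separate
CONSTRUCTION statement (Fredholmness of L_W in a
weighted space), never smuggling existence into the interface. Both are needed only for the layer-2
splits; no item at open depends on them.

Novelty: Searches (2026-08-15; searchd/vsearch down all session, OpenAlex cite path and galaxy up): `lit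
frontier NavierStokesRegularity --since 2023`
(30 rows: forced/non-uniqueness/quantitative 2026 papers, Hou2026, CIV; none with a dynamical law
for R); `lit galaxy search` ×6 --star all
("Euler-Leray equations", "logarithmic correction to the blow-up rate", "running coupling
Navier-Stokes", "slightly supercritical blow-up
rate", "Type II blow-up Navier-Stokes logarithm", "modulation equations self-similar blow-up
Navier-Stokes": 0 substring hits each);
`lit galaxy search --star pdf --mode intelligent "small viscosity perturbation of a self-similar
Euler singularity: drift of the dilation
parameter …"` (10: Eggers physics/0110087 hydrodynamic-singularity review, drop pinch-off,
sigma-model critical collapse — the generic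
'slow drift along a similarity family ⇒ log corrections' folklore, EggersFontelos2008 =
arXiv:0812.1339, never applied to NS/Leray); `lit read`
of arXiv:1806.04893 §5 (pp. 8–10), arXiv:2602.17570 (abstract, §1, §3), arXiv:2405.10916 (§1.2,
§5.4); the card's and the TRIAGE-22
refuter's searches (arXiv 'Euler-Leray equations singularity' 10 hits incl. PLBL; 'nearly
self-similar blowup NS logarithmic' 0).
Nearest prior art found: PomeauBerreLehner2018 §5 (arXiv:1806.04893; with Pomeau2017) — the
modulation/solvability law for the dilation
parameter of an Euler–Leray profile under small viscosity, heuristic, no sign, fates 'μ → 0 or fixed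
point' only; ConstantinIgnatova  [refs: 0812.1339, 1806.04893, 2602.17570, 2405.10916, Hou2026, EggersFontelos2008, PomeauBerreLehner2018, Pomeau2017, MerleRaphael2005, RaphaelSchweyer2011, MerleEtAl2022]

Barriers (technique_class: modulation-theory, marginal-rg, type-II-classification): - technique_class: modulation-theory, marginal-rg, type-II-classification
- Literature.Barriers.NavierStokesRegularity.LeraySelfSimilarBlowupExclusion: evaded by construction
and USED — the objects here have R(s) → ∞, so they are neither self-similar, asymptotically
self-similar in Leray normalisation (Chae2007) nor DSS (ChaeWolf2017RemovingDSS); NRŠ/Tsai kill the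
κ-fixed point (PLBL's second fate), which is what forces marginality.
- Literature.Barriers.NavierStokesRegularity.AxisymmetricTypeIExclusion: used as the exit kill
(NoTypeIBlowup) in the axisymmetric class — the κ < 0 branch drives R down to O(1), i.e. into the
barrier's hypothesis; the marginal regime is its exact complement.
- Literature.Barriers.NavierStokesRegularity.CriticalNormBlowupNecessity: consistent — along a
linear-creep orbit ‖u‖_{L³} grows like a power of |log(T−t)|, above Tao's triple-log floor; a proof
of NoLinearCreep in AX would give explicit log-type LOWER bounds on R, sharpening the barrier rather
than fighting it.
- Literature.Barriers.NavierStokesRegularity.TaoAveragedBlowup: the law for ε comes from the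
linearisation at a genuine Euler–Leray skeleton (Kelvin-neutral transport W+½y, symmetry zero modes,
Fredholm pairing) — structure an averaged bilinear form B̃ does not have; conceded: NoBreathing's
compactness step and NoTypeIBlowup (= (L′) outside symmetry) are rate statements and inherit
whatever bites Liouville; nothing here is an energy-class estimate.
- Literature.Barriers.NavierStokesRe

sub-problem: NavierStokesRegularity · status: open · opened planner-plancard-NavierStokesRegularity-Navie-c9cb2f0e-0 2026-08-15T19:50:54Z · rev 1 · ledger route-NavierStokesRegularity-MarginalReynoldsCreep
GENERATED by the gate from the ledger (D-0016/17). Provers cite these decls: `theorem foo : Summit.NavierStokesRegularity.NavierStokesRegularity.Theses.MarginalReynoldsCreep.<Decl> := …` in Summits/NavierStokesRegularity/NavierStokesRegularity/Theorems/<Name>.lean.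
-/

namespace Summit.NavierStokesRegularity.NavierStokesRegularity.Theses.MarginalReynoldsCreep

open scoped BigOperators Topology Manifold Classical MeasureTheory ProbabilityTheory Matrix InnerProductSpace ComplexConjugate ContinuousMap
open Filter Set Function TopologicalSpace MeasureTheory

attribute [summit_statement] _root_.NavierStokesRegularity

open Literature.NS

/-- item stmt-NavierStokesRegularity-0056 · target · rank 0 · open · by planner
why it might fail: a finite-energy Type-II singularity is ¬Clay(A) outright; Tao's averaged blow-up is Type II (arXiv:1402.0290 p.8), Hou's axisymmetric scenario would be Type II if singular (KNSS2009).
sources: KochNadirashviliSereginSverak2009, Hou2022PotentiallySingularNS, Seregin2024, Tao2021QuantitativeNS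
If a finite-energy classical solution from a rapidly decaying datum has maximal lifespan T<∞ (no
classical extension past T), then ‖u(t)‖_∞ ≤ C (T−t)^{-1/2} eventually as t↑T (Leray's rate is the
matching lower bound, leray_blowup_rate_top). The hardest and most informative crux: a
counterexample is a Type II singularity, i.e. ¬(Clay A). Known: lower bound c√ν (T−t)^{-1/2} (Leray
1934 §20); L³ must blow up (ESS 2003, Seregin 2012); only triple-log quantitative gain (Tao 2021). -/
@[route_item "route-NavierStokesRegularity-MarginalReynoldsCreep"]
def NoTypeII : Prop :=
  ∀ (ν T : ℝ), 0 < ν → 0 < T → ∀ (u : ℝ → EuclideanSpace ℝ (Fin 3) → EuclideanSpace ℝ (Fin 3)) (p : ℝ → EuclideanSpace ℝ (Fin 3) → ℝ), Literature.Analysis.FluidPDE.IsMaximalSmoothSolution ν 0 u p T → Literature.Analysis.FluidPDE.IsLerayHopfOn T ν 0 (u 0) u → Literature.Analysis.FluidPDE.HasRapidSpatialDecay (u 0) → Literature.Analysis.FluidPDE.IsTypeIBlowup u T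

/-- item stmt-NavierStokesRegularity-13636 · crux · rank 2 · open · by planner
why it might fail: L_W (transport by W+½y plus stretching) is non-normal with no spectral gap off the symmetry modes, so w need not stay slaved; zooms may not converge (chaotic/precessing skeleton); κ(W)=0 gives two-loop creep R~√s; swirl-starvation predicts R ≲ s^{2/3} in ω_θ-driven AX scenarios.
sources: PomeauBerreLehner2018, RaphaelSchweyer2011, MerleRaphael2005, MerleEtAl2022, Hou2026, arXiv:1204.4625
[crux] ONE-LOOP CREEP LAW (card K1, integrated and made unconditional). For a maximal finite-energy
classical solution from Clay data with R(t) = (T−t)‖u(t)‖²∞/ν → ∞ (∀M, eventually some x has M ≤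
(T−t)|u(t,x)|²) which is NOT strong Type II (no positive minorant m ≤ ‖u(t,x_t)‖ with ∫^T
dt/((T−t)²m²) < ∞, i.e. ∫ds/R = ∞), there is κ > 0 with (T−t)‖u(t)‖²∞/(ν|log(T−t)|) → κ (two-sided:
for every δ > 0, eventually some x beats (κ−δ) and all x stay below (κ+δ)). Mechanism: shadowing of
the γ = ½ Euler–Leray skeleton W modulo symmetries, modulation U = W(·;p(s)) + εW₁ + w, Fredholm
solvability ⇒ ε′ = −κ(W)ε² + o(ε²) ⇒ R/s → κ(W); marginality forces κ(W) ≥ 0 and one loop forces >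
0. [difficulty: XL] -/
@[route_item "route-NavierStokesRegularity-MarginalReynoldsCreep", crux]
def OneLoopCreep : Prop :=
  ∀ (ν T : ℝ), 0 < ν → 0 < T → ∀ (u : ℝ → EuclideanSpace ℝ (Fin 3) → EuclideanSpace ℝ (Fin 3)) (p : ℝ → EuclideanSpace ℝ (Fin 3) → ℝ), Literature.Analysis.FluidPDE.IsMaximalSmoothSolution ν 0 u p T → Literature.Analysis.FluidPDE.IsLerayHopfOn T ν 0 (u 0) u → Literature.Analysis.FluidPDE.HasRapidSpatialDecay (u 0) → (∀ M : ℝ, ∀ᶠ t in 𝓝[<] T, ∃ x, M ≤ (T - t) * ‖u t x‖ ^ 2) → (¬ ∃ (m : ℝ → ℝ) (t₀ : ℝ), t₀ < T ∧ (∀ t ∈ Set.Ioo t₀ T, 0 < m t ∧ ∃ x, m t ≤ ‖u t x‖) ∧ MeasureTheory.IntegrableOn (fun t => 1 / ((T - t) ^ 2 * (m t) ^ 2)) (Set.Ioo t₀ T)) → ∃ κ : ℝ, 0 < κ ∧ ∀ δ : ℝ, 0 < δ → ∀ᶠ t in 𝓝[<] T, (∃ x, (κ - δ) * ν * |Real.log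 (T - t)| ≤ (T - t) * ‖u t x‖ ^ 2) ∧ ∀ x, (T - t) * ‖u t x‖ ^ 2 ≤ (κ + δ) * ν * |Real.log (T - t)|

/-- item stmt-NavierStokesRegularity-13637 · crux · rank 3 · open · by planner
why it might fail: the sign is profile-dependent in every dispersive analogue (stable and unstable log regimes both occur); Hou's 10⁷-fold vorticity growth at fixed ν with |log|-dressed fits is numerical evidence FOR a κ > 0 skeleton — which would be ¬Clay(A).
sources: Hou2022PotentiallySingularNS, Hou2026, PomeauBerreLehner2018, MerleRaphael2005, ConstantinIgnatovaVicol2026Putative, Chae2007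
[crux] SIGN THEOREM, global form (card K2: "viscosity is marginally relevant", κ(W) < 0 for every
admissible Euler–Leray skeleton; equivalently no asymptotically free singularity). No maximal
finite-energy classical solution from Clay data has (T−t)‖u(t)‖²∞/(ν|log(T−t)|) → κ with 0 < κ < ∞
(two-sided, as in OneLoopCreep). Route of proof: linear creep ⇒ the sup-normalised zooms at the
advective length √(νR(T−t)) shadow a steady or log-periodic solution W of ½(W+y·∇W)+W·∇W+∇Π = 0 (C²,
|W| ≲ ⟨y⟩⁻¹, |∇W| ≲ ⟨y⟩⁻²) ⇒ κ = κ(W) = the Fredholm ratio of ⟨ΔW, Z⟩ against the dilation/amplitude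
adjoint zero modes ⇒ show κ(W) < 0 (axisymmetric bounded-swirl skeletons first), or that no
admissible W exists at all (card leray-euler-affine-bernoulli). [difficulty: open-problem] -/
@[route_item "route-NavierStokesRegularity-MarginalReynoldsCreep", crux]
def NoLinearCreep : Prop :=
  ∀ (ν T : ℝ), 0 < ν → 0 < T → ∀ (u : ℝ → EuclideanSpace ℝ (Fin 3) → EuclideanSpace ℝ (Fin 3)) (p : ℝ → EuclideanSpace ℝ (Fin 3) → ℝ), Literature.Analysis.FluidPDE.IsMaximalSmoothSolution ν 0 u p T → Literature.Analysis.FluidPDE.IsLerayHopfOn T ν 0 (u 0) u → Literature.Analysis.FluidPDE.HasRapidSpatialDecay (u 0) → ∀ κ : ℝ, 0 < κ → (∀ δ : ℝ, 0 < δ → ∀ᶠ t in 𝓝[<] T, (∃ x, (κ - δ) * ν * |Real.log (T - t)| ≤ (T - t) * ‖u t x‖ ^ 2) ∧ ∀ x, (T - t) * ‖u t x‖ ^ 2 ≤ (κ + δ) * ν * |Real.log (T - t)|) → False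

/-- item stmt-NavierStokesRegularity-13638 · crux · rank 4 · open · by planner
why it might fail: Kelvin pins γ=½ only for (approximately) SELF-SIMILAR Euler collapse with a trapped loop; a multiscale cascade or sheet roll-up can keep every circulation bounded while sup|u| outruns (T−t)^{-1/2} (ℓ ≪ |u|(T−t)); CIV need outgoing/analyticity hypotheses even in the self-similar case.
sources: ConstantinIgnatovaVicol2026Putative, GinibreLeberrePomeau2019, Chae2007, Seregin2024, Elgindi2025IdealFluidDynamics
[crux] KELVIN MARGINALITY — viscosity never integrates out. For a maximal finite-energy classical
solution from Clay data, R(t) → ∞ ⇒ ∫^∞ ds/R = ∞: there is NO positive minorant m(t) ≤ ‖u(t,x_t)‖ on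
some (t₀,T) with ∫ dt/((T−t)² m(t)²) < ∞ (this kills every power rate ‖u‖∞ ≳ (T−t)^{-a}, a > ½, i.e.
every collapse length (T−t)^γ with γ < ½). In print for outgoing / axisymmetric-with-swirl globally
self-similar Euler profiles (CIV 2026: circulation e^{(1−2γ)τ}Γ is invariant along self-similar
trajectories, so a trapped loop forces γ = ½); the crux is the statement for general finite-energy
NS singularities (shared in spirit with cards kelvin-quantized-similarity-exponent,
euler-window-viscous-transfer and route VortexLineClock's EmptyEulerWindow). [difficulty:
open-problem] -/
@[route_item "route-NavierStokesRegularity-MarginalReynoldsCreep", crux]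
def NoStrongTypeII : Prop :=
  ∀ (ν T : ℝ), 0 < ν → 0 < T → ∀ (u : ℝ → EuclideanSpace ℝ (Fin 3) → EuclideanSpace ℝ (Fin 3)) (p : ℝ → EuclideanSpace ℝ (Fin 3) → ℝ), Literature.Analysis.FluidPDE.IsMaximalSmoothSolution ν 0 u p T → Literature.Analysis.FluidPDE.IsLerayHopfOn T ν 0 (u 0) u → Literature.Analysis.FluidPDE.HasRapidSpatialDecay (u 0) → (∀ M : ℝ, ∀ᶠ t in 𝓝[<] T, ∃ x, M ≤ (T - t) * ‖u t x‖ ^ 2) → ¬ ∃ (m : ℝ → ℝ) (t₀ : ℝ), t₀ < T ∧ (∀ t ∈ Set.Ioo t₀ T, 0 < m t ∧ ∃ x, m t ≤ ‖u t x‖) ∧ MeasureTheory.IntegrableOn (fun t => 1 / ((T - t) ^ 2 * (m t) ^ 2)) (Set.Ioo t₀ T)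

/-- item stmt-NavierStokesRegularity-13639 · crux · rank 5 · open · by planner
why it might fail: a log-periodic (DSS-like) skeleton with exactly zero cycle-averaged κ ('breathing DSS', R oscillating between O(1) and ∞ along t↑T) is non-generic but not obviously impossible; Type-I(M) compactness controls similarity-time windows, not their number.
sources: AlbrittonBarker2019, ChaeWolf2017RemovingDSS, SereginSverak2009, Seregin2024, KochNadirashviliSereginSverak2009
[crux] NO BREATHING (card K3). For a maximal finite-energy classical solution from Clay data,
failure of the Type-I bound (limsup R = ∞) forces R(t) → ∞ (∀M, eventually in t some x has M ≤
(T−t)|u(t,x)|²): the running coupling cannot return to O(1) infinitely often. Intended proof: from a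
quiescent similarity-time window with R ≤ M, compactness of Type-I(M) configurations
(Albritton–Barker / Seregin local Type-I calculus) bounds the amplification reachable in similarity
time τ by G(M,τ), so bursts of unbounded height need unbounded build-up windows; show a recurrent
skeleton cannot have identically vanishing cycle-averaged κ. [difficulty: L] -/
@[route_item "route-NavierStokesRegularity-MarginalReynoldsCreep", crux]
def NoBreathing : Prop :=
  ∀ (ν T : ℝ), 0 < ν → 0 < T → ∀ (u : ℝ → EuclideanSpace ℝ (Fin 3) → EuclideanSpace ℝ (Fin 3)) (p : ℝ → EuclideanSpace ℝ (Fin 3) → ℝ), Literature.Analysis.FluidPDE.IsMaximalSmoothSolution ν 0 u p T → Literature.Analysis.FluidPDE.IsLerayHopfOn T ν 0 (u 0) u → Literature.Analysis.FluidPDE.HasRapidSpatialDecay (u 0) → ¬ Literature.Analysis.FluidPDE.IsTypeIBlowup u T → ∀ M : ℝ, ∀ᶠ t in 𝓝[<] T, ∃ x, M ≤ (T - t) * ‖u t x‖ ^ 2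

/-- item stmt-NavierStokesRegularity-17672 · crux · rank 6 · open · by planner
why it might fail: Pulse breather: tall thin pulses (viscous-scale, energy ~H^{-1/2}) erupting from a Type-I(M) background within log-time -> 0 are invisible to energy/CKN quantities; every local-existence clock (L^inf, Lipschitz, BKM) gives horizon ~nu/M -> 0, and no compactness holds past Leray's window.
sources: Leray1934, OzanskiPooley2018, AlbrittonBarker2019, BarkerPrange2021, GigaInuiMatsui1999, arXiv:2606.29468
[crux] AMPLIFICATION HORIZON UNIFORM IN THE LEVEL (piece X1 of the typed split of NoBreathing;
strategist 2026-08-17). For a maximal finite-energy classical solution from Clay data which is NOT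
Type I there is ONE similarity horizon tau0 > 0 such that for EVERY level M > 0 some G = G(M) bounds
the running coupling, (T-t)|u(t,x)|^2 <= G, for all t >= t0 with T - t >= e^{-tau0}(T - t0), after
every late Type-I(M) slice t0 (forall x, (T-t0)|u(t0,x)|^2 <= M). Known: Leray's local theory (Leray
1934 §19 (3.8); Ozanski-Pooley 2018 Thm 6.22, Cor 6.25; tree: leray_strong_local_existence,
leray_blowup_rate_top) gives the LEVEL-DEPENDENT horizon theta(M) ~ c nu/M with G = 4M; iterating it
only reaches the finite horizon sum_j theta(4^j M) < infinity, so the content is exactly that the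
horizon does not degenerate as M -> infinity ('tall spikes need long run-ups'). Kills PULSE-TYPE
breathing (tall thin pulses squeezed between log-dense Type-I slices). With X2 it gives NoBreathing
(glue NoBreathingSplitGlue, PROVED: Cruxes/NoBreathing/Split.lean, window induction + covering, ~200
lines); conversely NoBreathing => X1 (proved there), so X1 is strictly a piece. Birth skeleton:
Lines/amplification- -/
@[route_item "route-NavierStokesRegularity-MarginalReynoldsCreep", crux]
def AmplificationHorizon : Prop :=
  ∀ (ν T : ℝ), 0 < ν → 0 < T → ∀ (u : ℝ → EuclideanSpace ℝ (Fin 3) → EuclideanSpace ℝ (Fin 3)) (p : ℝ → EuclideanSpace ℝ (Fin 3) → ℝ), Literature.Analysis.FluidPDE.IsMaximalSmoothSolution ν 0 u p T → Literature.Analysis.FluidPDE.IsLerayHopfOn T ν 0 (u 0) u → Literature.Analysis.FluidPDE.HasRapidSpatialDecay (u 0) → ¬ Literature.Analysis.FluidPDE.IsTypeIBlowup u T → ∃ τ₀ : ℝ, 0 < τ₀ ∧ ∀ M : ℝ, 0 < M → ∃ G : ℝ, ∀ᶠ t₀ in 𝓝[<] T, (∀ x, (T - t₀) * ‖u t₀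 x‖ ^ 2 ≤ M) → ∀ t : ℝ, t₀ ≤ t → Real.exp (-τ₀) * (T - t₀) ≤ T - t → ∀ x, (T - t) * ‖u t x‖ ^ 2 ≤ G

/-- item stmt-NavierStokesRegularity-17673 · crux · rank 7 · open · by planner
why it might fail: Nothing known forbids aborted Type-II attempts: a concentrating core can disintegrate viscously (fast fall of R is trivially possible for fine-scale spikes) and relax to Type-I(M) after an arbitrarily long super-M episode; zooms at the return slices have no compactness beyond Leray's window.
sources: Seregin2012, KochNadirashviliSereginSverak2009, ChaeWolf2017RemovingDSS, EscauriazaSereginSverak2003, arXiv:2606.29468, AlbrittonBarker2019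
[crux] NO LATE RELAXATION — irreversibility of sustained super-Type-I episodes (piece X2 of the
typed split of NoBreathing; strategist 2026-08-17). For a maximal finite-energy classical solution
from Clay data which is NOT Type I and every level M > 0 there is a log-length L = L(M) > 0 such
that for all late s: if t in (s,T) lies at similarity distance >= L after s (T - t <= e^{-L}(T - s))
and NO slice r in (s,t] is Type-I(M) (forall r, exists x, M < (T-r)|u(r,x)|^2), then no slice in
[t,T) is Type-I(M) either — once the coupling has stayed above M for L units of log-time it never
returns to M. Kills QUIESCENT-TYPE breathing (repeated aborted Type-II attempts: longer and longer
active episodes relaxing back to Type-I(M)); log-periodic (DSS) objects have bounded gaps and are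
not the enemy (Chae-Wolf 2017), the enemy is a growing-amplitude, sparsening modulation. With X1 it
gives NoBreathing (glue NoBreathingSplitGlue, PROVED in Cruxes/NoBreathing/Split.lean); conversely
NoBreathing => X2 (proved there). No printed tool converts a return-to-Type-I into a constraint on
the preceding episode (backward uniqueness is qualitative; backward parabolic estimates are
ill-posed); nearest prece -/
@[route_item "route-NavierStokesRegularity-MarginalReynoldsCreep", crux]
def NoLateRelaxation : Prop :=
  ∀ (ν T : ℝ), 0 < ν → 0 < T → ∀ (u : ℝ → EuclideanSpace ℝ (Fin 3) → EuclideanSpace ℝ (Fin 3)) (p : ℝ → EuclideanSpace ℝ (Fin 3) → ℝ), Literature.Analysis.FluidPDE.IsMaximalSmoothSolution ν 0 u p T → Literature.Analysis.FluidPDE.IsLerayHopfOn T ν 0 (u 0) u → Literature.Analysis.FluidPDE.HasRapidSpatialDecay (u 0) → ¬ Literature.Analysis.FluidPDE.IsTypeIBlowup u T → ∀ M : ℝ, 0 < M → ∃ L : ℝ, 0 < L ∧ ∀ᶠ s in 𝓝[<] T, ∀ t : ℝ, s < t → t < T → T - t ≤ Real.exp (-L) * (T - s) → (∀ r : ℝ,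 s < r → r ≤ t → ∃ x, M < (T - r) * ‖u r x‖ ^ 2) → ∀ t' : ℝ, t ≤ t' → t' < T → ∃ x, M < (T - t') * ‖u t' x‖ ^ 2

/-- item stmt-NavierStokesRegularity-0055 · support · rank 9 · closed · proved by Summit.NavierStokesRegularity.NavierStokesRegularity.Theorems.typeICertificateLadder_noBlowupToClay_proof @ 8d57e70af7e2 (prover) · by planner
sources: Leray1934, Fefferman2000, KochNadirashviliSereginSverak2009
Given NoBlowup, build the Clay (A) solution: local finite-energy classical solution for smooth
divergence-free rapidly decaying data (Leray 1934 §III / Fujita–Kato 1964 + LPS smoothing), continue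
past every T using NoBlowup, glue by weak–strong uniqueness (Prodi–Serrin), bounded energy from the
energy inequality, and convert with
Literature.Analysis.FluidPDE.isNavierStokesSolution_and_smooth_iff. Blow-up at spatial infinity is
excluded by CKN ε-regularity applied far out. May take named Literature facts (leray_existence_R3,
ladyzhenskaya_prodi_serrin, weak_strong_uniqueness, fujita_kato_local) as hypotheses if the grounder
so rules. -/
@[route_item "route-NavierStokesRegularity-MarginalReynoldsCreep", crux]
def NoBlowupToClay : Prop :=
  (∀ (ν T : ℝ), 0 < ν → 0 < T → ∀ (u : ℝ → EuclideanSpace ℝ (Fin 3) → EuclideanSpace ℝ (Fin 3)) (p : ℝ → EuclideanSpace ℝ (Fin 3) → ℝ), Literature.Analysis.FluidPDE.IsClassicalNSSolutionOn (Set.Ico 0 T) ν 0 u p → Literature.Analysis.FluidPDE.IsLerayHopfOn T ν 0 (u 0) u → Literature.Analysis.FluidPDE.HasRapidSpatialDecay (u 0) → Literature.Analysis.FluidPDE.HasSmoothExtensionPast ν 0 u T) → NavierStokesRegularity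

/-- `NoBlowupToClay` holds: proved by `Summit.NavierStokesRegularity.NavierStokesRegularity.Theorems.typeICertificateLadder_noBlowupToClay_proof` @ 8d57e70af7e2. -/
theorem NoBlowupToClay_holds : NoBlowupToClay := _root_.Summit.NavierStokesRegularity.NavierStokesRegularity.Theorems.typeICertificateLadder_noBlowupToClay_proof

/-- item stmt-NavierStokesRegularity-1217 · support · rank 9 · open · by planner
sources: KochNadirashviliSereginSverak2009, SereginSverak2009, AlbrittonBarker2019
[target] X = NO TYPE-I BLOW-UP FOR CLAY DATA: a classical solution of unforced NS on ℝ³×[0,T) which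
is Leray–Hopf from a rapidly decaying datum and blows up at most at the Type-I rate ‖u(t)‖∞ ≤
C(T−t)^{-1/2} extends smoothly past T. Equals UnthreadedNoBlowup ∧ ThreadedNoBlowup by excluded
middle on 'every point is unthreaded' (proved in the planner's Sketch.lean: target_of_cruxes); it is
the unconditional conclusion of stmt-NavierStokesRegularity-0058 (route TypeILiouville, which
assumes (L)). With NoTypeII (stmt-0056) it gives NoBlowup (stmt-0054). Card:
threading-flux-trace-topology. -/
@[route_item "route-NavierStokesRegularity-MarginalReynoldsCreep", crux]
def NoTypeIBlowup : Prop :=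
  ∀ (ν T : ℝ), 0 < ν → 0 < T → ∀ (u : ℝ → EuclideanSpace ℝ (Fin 3) → EuclideanSpace ℝ (Fin 3)) (p : ℝ → EuclideanSpace ℝ (Fin 3) → ℝ), Literature.Analysis.FluidPDE.IsClassicalNSSolutionOn (Set.Ico 0 T) ν 0 u p → Literature.Analysis.FluidPDE.IsLerayHopfOn T ν 0 (u 0) u → Literature.Analysis.FluidPDE.HasRapidSpatialDecay (u 0) → Literature.Analysis.FluidPDE.IsTypeIBlowup u T → Literature.Analysis.FluidPDE.HasSmoothExtensionPast ν 0 u T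

/-- item stmt-NavierStokesRegularity-17688 · support · rank 9 · closed · proved by Summit.NavierStokesRegularity.NavierStokesRegularity.Theorems.NoBreathingSplit.marginalReynoldsCreep_noBreathingSplitGlue_proof (prover) · by planner
[support] GLUE of the crux-strategist typed decomposition of the restated crux NoBreathing
(stmt-NavierStokesRegularity-13639; BC2 redirect 2026-08-17; `route edit --split` is
final-cycle-only, so the decomposition is filed flat, as on routes SqueezeCycle / SubcubicESS):
AmplificationHorizon → NoLateRelaxation → NoBreathing. PROVABLE NOW — in fact PROVED: theorem
noBreathing_of_amplificationHorizon_of_noLateRelaxation in the strategist's crux workfile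
Cruxes/NoBreathing/Split.lean (lean check rc0, 0 sorry, axioms standard), and with both pieces
inlined verbatim as Theorems candidate marginalReynoldsCreep_noBreathing_of_split (folder
TheoremsSplit.lean, rc0) — this item is closed by `fun h₁ h₂ =>
marginalReynoldsCreep_noBreathing_of_split h₁ h₂` once a prover lands that file as
Theorems/MarginalReynoldsCreepNoBreathingSplit.lean (Theorems/ is prover-only). Proof (≈200 lines of
filter/real bookkeeping, not a one-line seam): (1) WINDOW INDUCTION — from X₁'s level-uniform
horizon τ₀, late Type-I(M) slices are followed by coupling ≤ G_n(M) over the similarity horizon n·τ₀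
for every n (restart at the end slice of each window at level max(G,1)); (2) COVERING — if Type-I(M)
slices recur (n -/
@[route_item "route-NavierStokesRegularity-MarginalReynoldsCreep"]
def NoBreathingSplitGlue : Prop :=
  Summit.NavierStokesRegularity.NavierStokesRegularity.Theses.MarginalReynoldsCreep.AmplificationHorizon → Summit.NavierStokesRegularity.NavierStokesRegularity.Theses.MarginalReynoldsCreep.NoLateRelaxation → Summit.NavierStokesRegularity.NavierStokesRegularity.Theses.MarginalReynoldsCreep.NoBreathing

-- `NoBreathingSplitGlue` holds: proved by `Summit.NavierStokesRegularity.NavierStokesRegularity.Theorems.NoBreathingSplit.marginalReynoldsCreep_noBreathingSplitGlue_proof` (its module imports this route file, so no `_holds` link can be stated here).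

/-- item stmt-NavierStokesRegularity-13640 · assembly · rank 1 · closed · proved by Summit.NavierStokesRegularity.NavierStokesRegularity.Theorems.marginalReynoldsCreep_assembly_proof (prover) · by planner
sources: KochNadirashviliSereginSverak2009, Fefferman2000
[assembly] OneLoopCreep → NoLinearCreep → NoStrongTypeII → NoBreathing → NoTypeIBlowup →
NoBlowupToClay → NavierStokesRegularity. -/
@[route_item "route-NavierStokesRegularity-MarginalReynoldsCreep"]
def Assembly : Prop :=
  OneLoopCreep → NoLinearCreep → NoStrongTypeII → NoBreathing → NoTypeIBlowup → NoBlowupToClay → NavierStokesRegularity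

-- `Assembly` holds: proved by `Summit.NavierStokesRegularity.NavierStokesRegularity.Theorems.marginalReynoldsCreep_assembly_proof` (its module imports this route file, so no `_holds` link can be stated here).

/-! D-0027 §2.1 — DECIDING THEOREM (planner-authored via `route open/edit --closes-file`; by planner-plancard-NavierStokesRegularity-Navie-c9cb2f0e-0 2026-08-15T19:50:54Z):
its hypotheses are this route's items and its conclusion the sub-problem Statement (glue_lint), and it elaborates with this file. -/

@[closes "route-NavierStokesRegularity-MarginalReynoldsCreep"] theorem closes (h₂ : OneLoopCreep) (h₃ : NoLinearCreep) (h₄ : NoStrongTypeII) (h₅ : NoBreathing)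
    (hI : NoTypeIBlowup) (hC : NoBlowupToClay) : NavierStokesRegularity := by
  refine hC ?_
  intro ν T hν hT u p hcl hLH hdec
  by_contra hne
  have hmax : Literature.Analysis.FluidPDE.IsMaximalSmoothSolution ν 0 u p T := ⟨hcl, hne⟩
  by_cases hI' : Literature.Analysis.FluidPDE.IsTypeIBlowup u T
  · exact hne (hI ν T hν hT u p hcl hLH hdec hI')
  · -- Type II: no breathing ⇒ R → ∞; Kelvin marginality ⇒ viscosity never integrates out (marginal);
    -- one-loop law ⇒ linear creep with a positive rate; the sign theorem forbids it.
    have hRD := h₅ ν T hν hT u p hmax hLH hdec hI'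
    have hns := h₄ ν T hν hT u p hmax hLH hdec hRD
    obtain ⟨κ, hκ, hcreep⟩ := h₂ ν T hν hT u p hmax hLH hdec hRD hns
    exact h₃ ν T hν hT u p hmax hLH hdec κ hκ hcreep

end Summit.NavierStokesRegularity.NavierStokesRegularity.Theses.MarginalReynoldsCreep
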